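import Summits.QuantumFields.YangMills.Theorems.UnitScaleTiltProp7SPrintDefs
import Summits.QuantumFields.YangMills.Theorems.UnitScaleTiltProp7SymAvgTwSymDefs
import Summits.QuantumFields.YangMills.Theorems.UnitScaleTiltProp7SectET3GaugeProjectorT3
import HarnessLib

/-!
# Route `UnitScaleTilt`, crux K1 child «MinimiserStabilityRegPr» (stmt-QuantumFields-19200), stub EX, route (α) — DEFINITIONS FILE: **THE SYMMETRIC SLICE LETTER
# `AvgCondPrintS`** (OWNER RULING g26-№19 (α-S), 2026-08-28 08:23Z, ORDER (1): «`AvgCondPrintS F n K h V U₀ X := ∀ U₁ = e^{iX}, ∃ u, NormS u ∧ gaugeAct u (emb15 U₀ U₁) ∈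
# fibre F ℰp n K h V` where `NormS u` := EXACTLY the witness properties a downstream row reads — today: «axial below the top w.r.t. `U₀`» ∧ «top-centre values =
# `(frameTwS U₀ (iX) ·)⁻¹`»»): the (20)-clause of the EX display RE-BASED WITH THE CHART OF RECORD (✓`Prop7SymAvgTwSym.logChartTwS`, symmetric centre-anchored frames).

Cell `ym3-torus` ∕ width seat `ym-ust-20520-w5` (gen 3).  YM₃ on T³ is ladder rung R3, not the Clay problem; nothing here is a claim about the stub, the crux or the gap.

THE PRINT AND THE RE-BASE.  [Balaban1985Variational] (20) «Q_j(U₀, ηA) = B on Λ_j» in its defining form [Balaban1985RegularSpaces] (1.28)–(1.30) p. 81: «U′ = (U₁U₀)^u in the axial gauge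
(1.19) with u restricted by (1.29) … Ũ′ʲ = V(Ū₀ʲ)⁻¹», the witness `u` having centre values «u(y) = (\overline{R_{0,y}U₁}^{(k)})⁻¹ (87)» [Balaban1985Averaging] p. 31 — the inverse
ACCUMULATED COMB frames, forced by (1.29)+(1.19) (✓`Prop7ChartSigmaT3.toUnits_descTransf_eq_wrec_inv`).  `Prop7SPrint.AvgCondPrint` is that clause verbatim (`RestrictedPrint` =
(1.29), `IsAxialPrint` = (1.19)), hence INTRINSICALLY COMB-framed: its level set is the (T) chart's (✓`Prop7SymAvgTwEq137.logChartTw_eq_mlog_iff_eq137cov`), not the re-based chart's.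
RULING g26-№19 re-bases the SLICE with the chart: the witness is normalised by (1.19) (axial below the top, w.r.t. `U₀` — a condition on the transformed FIELD, unchanged) and,
in place of (1.29), by the EXPLICIT top-centre clause «`u↓(y) = (w^{sym}_{iX}(y))⁻¹`» with the symmetric accumulated frame `frameTwS` of the chart of record — the S twin of (87)
as a DEFINING clause.  The level set of `logChartTwS` IS this slice (✓`Prop7SymAvgTwSymSlice.descendToGL_gaugeActT_eq_of_logChartTwS_eq_mlog`, `GL` letters); such `u` exist
and are unique (axial extension downward from prescribed top-centre data); their smallness follows from the frame bound W2 (`…Prop7SymFrameIterSmall`) — NOT displayed here.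

CONTENTS.  `NormS` (the two witness clauses), `AvgCondPrintS` (the re-based (20)), `rfl` unfoldings, the two projections, and the `GL` reading of the centre clause in the letters of
✓`Prop7SymAvgTwSymSlice` (`transfUp (toUnits ∘ toUGauge u) (K − n) ŷ = (frameTwS …)⁻¹`).  HONEST SCOPE: definitions (review lane) + bookkeeping; a DISPLAY letter, asserted for nothing;
no registered text, binder or route file is touched (RULING №19: «display-row decision (cell DEPMAP), NOT a route-binder∕registered-text edit»).  `--supports stmt-QuantumFields-19200 --as helper`.

References: T. Bałaban, CMP 102 (1985) 277–309 [Balaban1985Variational] ((19)–(21) p.281, Prop. 2 p.281); CMP 99 (1985) 75–102 [Balaban1985RegularSpaces] ((1.19) p.79, (1.28)–(1.31)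
pp.81–82, (1.37) p.82); CMP 98 (1985) 17–51 [Balaban1985Averaging] ((11)–(13) p.19, (85)–(89) p.31, (97) p.32).
-/

noncomputable section

namespace Summit.QuantumFields.YangMills.Theorems.Prop7SPrint

open scoped Matrix.Norms.L2Operator
open NormedSpace
open Literature.MathematicalPhysics.QuantumFieldTheory.Balaban1983to89
open Literature.MathematicalPhysics.QuantumFieldTheory.Balaban1983to89.T3ContinuumYM3Torus
open Literature.MathematicalPhysics.QuantumFieldTheory.Balaban1983to89.T3UnitLawDensityEML (ℰp)
open Literature.MathematicalPhysics.QuantumFieldTheory.Balaban1983to89.T3PrintedRegularOrbits (descTransf sites_eq)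
open Literature.MathematicalPhysics.QuantumFieldTheory.Balaban1983to89.T3ConstrainedMinimiser (fibre)
open T4Continuum (transfUp)
open T3LevelShift (siteShift)
open B8Thm2SetupTorus (toUGauge toUGauge_apply)
open T3SectALandauChart (emb15)
open Summit.QuantumFields.YangMills.Theorems.Prop7SymAvgTwSym (frameTwS)

variable (F : T3Family) (n K : ℕ) (h : n ≤ K)

/-! ## §1 The witness normalisation `NormS` and the re-based (20) `AvgCondPrintS` -/

/-- **`NormS` — THE NORMALISATION OF THE SYMMETRIC SLICE'S WITNESS** (RULING g26-№19 (1): «EXACTLY the witness properties a downstream row reads»): for the background `U₀`, the chart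
exponent `X` (the chart point is `U₁ = e^{iX}`), the configuration `U₁` and a fine gauge transformation `u`:
(i) **axial below the top w.r.t. `U₀`** — print's (1.19) for the transformed field `(U₁U₀)^u` (`IsAxialPrint`, a condition on the FIELD; unchanged from print), and
(ii) **top-centre values = the inverse SYMMETRIC accumulated frames of the chart of record**: `u↓(y) = (w^{sym}_{iX}(y))⁻¹` for every comparison site `y` (`descTransf` = `u` read at
the iterated block centres; `frameTwS` of ✓`Prop7SymAvgTwSym`) — the S twin of print's (87), replacing (1.29).  [cite: Balaban1985RegularSpaces, (1.19) p.79, (1.28)–(1.29) p.81; Balaban1985Averaging, (87) p.31] -/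
def NormS (U₀ : GaugeField (F.P K) 0 (Matrix.specialUnitaryGroup (Fin 2) ℂ)) (X : PBond (F.P K) 0 → Matrix (Fin 2) (Fin 2) ℂ)
    (U₁ : GaugeField (F.P K) 0 (Matrix.specialUnitaryGroup (Fin 2) ℂ)) (u : GaugeTransf (F.P K) 0 (Matrix.specialUnitaryGroup (Fin 2) ℂ)) : Prop :=
  IsAxialPrint F n K U₀ (GaugeField.gaugeAct u (emb15 U₀ U₁)) ∧
    ∀ y : Site (F.P n) 0,
      Unitary.toUnits (toUGauge (F.P n) 2 (descTransf F n K h u) y) = (frameTwS F n K h U₀ (fun b => Complex.I • X b) y)⁻¹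

/-- **`AvgCondPrintS` — (20) RE-BASED WITH THE CHART OF RECORD (the SYMMETRIC slice Σ_kˢ)**: every configuration `U₁` with the bond values `e^{iX(b)}` is carried INTO the fibre
`𝔅_k(𝔅_k, V)` by a gauge transformation `u` with `NormS` — «the orbit of `e^{iX}U₀` meets the fibre of `V` through the symmetric transversal».  Replaces `AvgCondPrint` (print's comb
slice) in the EX display per RULING g26-№19; same binder shape `(V) (U₀) (X)`. [cite: Balaban1985Variational, (20) p.281; Balaban1985RegularSpaces, (1.28)–(1.30) p.81; Balaban1985Averaging, (87) p.31] -/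
def AvgCondPrintS (V : GaugeField (F.P n) 0 (Matrix.specialUnitaryGroup (Fin 2) ℂ)) (U₀ : GaugeField (F.P K) 0 (Matrix.specialUnitaryGroup (Fin 2) ℂ))
    (X : PBond (F.P K) 0 → Matrix (Fin 2) (Fin 2) ℂ) : Prop :=
  ∀ U₁ : GaugeField (F.P K) 0 (Matrix.specialUnitaryGroup (Fin 2) ℂ),
    (∀ b : PBond (F.P K) 0, ((U₁ b : Matrix.specialUnitaryGroup (Fin 2) ℂ) : Matrix (Fin 2) (Fin 2) ℂ) = exp (Complex.I • X b)) →
      ∃ u : GaugeTransf (F.P K) 0 (Matrix.specialUnitaryGroup (Fin 2) ℂ),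
        NormS F n K h U₀ X U₁ u ∧ GaugeField.gaugeAct u (emb15 U₀ U₁) ∈ fibre F ℰp n K h V

/-! ## §2 Unfoldings and projections -/

variable {F n K h}

/-- `NormS` unfolded. [cite: Balaban1985RegularSpaces, (1.28)–(1.29) p.81] -/
theorem normS_iff (U₀ : GaugeField (F.P K) 0 (Matrix.specialUnitaryGroup (Fin 2) ℂ)) (X : PBond (F.P K) 0 → Matrix (Fin 2) (Fin 2) ℂ)
    (U₁ : GaugeField (F.P K) 0 (Matrix.specialUnitaryGroup (Fin 2) ℂ)) (u : GaugeTransf (F.P K) 0 (Matrix.specialUnitaryGroup (Fin 2) ℂ)) :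
    NormS F n K h U₀ X U₁ u ↔
      IsAxialPrint F n K U₀ (GaugeField.gaugeAct u (emb15 U₀ U₁)) ∧
        ∀ y : Site (F.P n) 0,
          Unitary.toUnits (toUGauge (F.P n) 2 (descTransf F n K h u) y) = (frameTwS F n K h U₀ (fun b => Complex.I • X b) y)⁻¹ := Iff.rfl

/-- the axial clause of `NormS`. [cite: Balaban1985RegularSpaces, (1.19) p.79] -/
theorem NormS.isAxialPrint {U₀ : GaugeField (F.P K) 0 (Matrix.specialUnitaryGroup (Fin 2) ℂ)} {X : PBond (F.P K) 0 → Matrix (Fin 2) (Fin 2) ℂ}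
    {U₁ : GaugeField (F.P K) 0 (Matrix.specialUnitaryGroup (Fin 2) ℂ)} {u : GaugeTransf (F.P K) 0 (Matrix.specialUnitaryGroup (Fin 2) ℂ)}
    (hu : NormS F n K h U₀ X U₁ u) : IsAxialPrint F n K U₀ (GaugeField.gaugeAct u (emb15 U₀ U₁)) := hu.1

/-- the centre clause of `NormS`: `u↓(y) = (w^{sym}_{iX}(y))⁻¹`. [cite: Balaban1985Averaging, (87) p.31] -/
theorem NormS.toUnits_descTransf_eq {U₀ : GaugeField (F.P K) 0 (Matrix.specialUnitaryGroup (Fin 2) ℂ)} {X : PBond (F.P K) 0 → Matrix (Fin 2) (Fin 2) ℂ}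
    {U₁ : GaugeField (F.P K) 0 (Matrix.specialUnitaryGroup (Fin 2) ℂ)} {u : GaugeTransf (F.P K) 0 (Matrix.specialUnitaryGroup (Fin 2) ℂ)}
    (hu : NormS F n K h U₀ X U₁ u) (y : Site (F.P n) 0) :
    Unitary.toUnits (toUGauge (F.P n) 2 (descTransf F n K h u) y) = (frameTwS F n K h U₀ (fun b => Complex.I • X b) y)⁻¹ := hu.2 y

/-- `AvgCondPrintS` unfolded. [cite: Balaban1985Variational, (20) p.281] -/
theorem avgCondPrintS_iff (V : GaugeField (F.P n) 0 (Matrix.specialUnitaryGroup (Fin 2) ℂ)) (U₀ : GaugeField (F.P K) 0 (Matrix.specialUnitaryGroup (Fin 2) ℂ))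
    (X : PBond (F.P K) 0 → Matrix (Fin 2) (Fin 2) ℂ) :
    AvgCondPrintS F n K h V U₀ X ↔
      ∀ U₁ : GaugeField (F.P K) 0 (Matrix.specialUnitaryGroup (Fin 2) ℂ),
        (∀ b : PBond (F.P K) 0, ((U₁ b : Matrix.specialUnitaryGroup (Fin 2) ℂ) : Matrix (Fin 2) (Fin 2) ℂ) = exp (Complex.I • X b)) →
          ∃ u : GaugeTransf (F.P K) 0 (Matrix.specialUnitaryGroup (Fin 2) ℂ),
            NormS F n K h U₀ X U₁ u ∧ GaugeField.gaugeAct u (emb15 U₀ U₁) ∈ fibre F ℰp n K h V := Iff.rfl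

/-- **THE RE-BASED (20) FROM A WITNESS**: a `NormS`-normalised `u` carrying `e^{iX}U₀` into the fibre gives `AvgCondPrintS` (the chart point's bond values determine `U₁`).
[cite: Balaban1985Variational, (20) p.281; Balaban1985RegularSpaces, (1.28)–(1.30) p.81] -/
theorem avgCondPrintS_of_witness {V : GaugeField (F.P n) 0 (Matrix.specialUnitaryGroup (Fin 2) ℂ)} {U₀ : GaugeField (F.P K) 0 (Matrix.specialUnitaryGroup (Fin 2) ℂ)}
    {X : PBond (F.P K) 0 → Matrix (Fin 2) (Fin 2) ℂ}
    (hw : ∀ U₁ : GaugeField (F.P K) 0 (Matrix.specialUnitaryGroup (Fin 2) ℂ),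
      (∀ b : PBond (F.P K) 0, ((U₁ b : Matrix.specialUnitaryGroup (Fin 2) ℂ) : Matrix (Fin 2) (Fin 2) ℂ) = exp (Complex.I • X b)) →
        ∃ u : GaugeTransf (F.P K) 0 (Matrix.specialUnitaryGroup (Fin 2) ℂ), NormS F n K h U₀ X U₁ u ∧ GaugeField.gaugeAct u (emb15 U₀ U₁) ∈ fibre F ℰp n K h V) :
    AvgCondPrintS F n K h V U₀ X := hw

/-! ## §3 The centre clause in the `GL₂(ℂ)` letters of ✓`Prop7SymAvgTwSymSlice` -/

/-- `transfUp` commutes with post-composition by any map (both just re-index along the block centres). [cite: Balaban1985Averaging, (12)–(13) p.19] -/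
theorem transfUp_comp {P : Params} {G H : Type*} (φ : G → H) (u : GaugeTransf P 0 G) :
    ∀ (j : ℕ) (y : Site P j), transfUp (fun x => φ (u x)) j y = φ (transfUp u j y)
  | 0, _ => rfl
  | j + 1, y => transfUp_comp φ u j (emb y)

/-- ★ **THE CENTRE CLAUSE, `GL` FORM**: under `NormS`, the units-valued fine gauge map `ũ := toUnits ∘ toUGauge u` satisfies the hypothesis `hũ` of ✓`Prop7SymAvgTwSymSlice`
(`transfUp ũ (K − n) ŷ = (frameTwS U₀ (iX) y)⁻¹`), so `descendToGL_gaugeActT_eq_iff` ∕ `…_of_logChartTwS_eq_mlog` read on the witness.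
[cite: Balaban1985Averaging, (11)–(13) p.19, (87) p.31] -/
theorem NormS.transfUp_toUnits_eq {U₀ : GaugeField (F.P K) 0 (Matrix.specialUnitaryGroup (Fin 2) ℂ)} {X : PBond (F.P K) 0 → Matrix (Fin 2) (Fin 2) ℂ}
    {U₁ : GaugeField (F.P K) 0 (Matrix.specialUnitaryGroup (Fin 2) ℂ)} {u : GaugeTransf (F.P K) 0 (Matrix.specialUnitaryGroup (Fin 2) ℂ)}
    (hu : NormS F n K h U₀ X U₁ u) (y : Site (F.P n) 0) :
    transfUp (fun x : Site (F.P K) 0 => Unitary.toUnits (toUGauge (F.P K) 2 u x)) (K - n) (siteShift (sites_eq F n K h) y)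
      = (frameTwS F n K h U₀ (fun b => Complex.I • X b) y)⁻¹ := by
  rw [← hu.2 y, transfUp_comp]
  congr 1
  exact transfUp_comp (fun g : Matrix.specialUnitaryGroup (Fin 2) ℂ => B10Eq27TorusAxialLog.suIncl g) u (K - n) (siteShift (sites_eq F n K h) y)


/-! ## §4 (21)ˢ — THE PROJECTED LANDAU GAUGE CONDITION FOR THE SYMMETRIC TUBE: `IsLandauPrintS` (v2 APPEND; ★★OWNER ACK 32 (q1) ∕ ACK 37; seat `ym-ust-20520-w4` g3)

RULING g26-№19 moved the EX slice to the S letters; ACK 32 (q1) ruled the gauge projector INTRINSIC: `N_S(U₀) := ker (Q(U₀) ∘ D_{U₀})` for the averaging OF RECORD `Q := QTwS`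
and `R_S(U₀) :=` the orthogonal projection onto `Δ^η_{U₀} N_S(U₀)` — ym-inputs-p01's bricks ✓L0a `Prop7SectET3HilbertLetters` (`toL2`, `DL2`, `DstarL2`, `covLapSite`, `QL2`) and
✓L0c `Prop7SectET3GaugeProjector` (`QDS`, `NS`, `RS`, `RSPi`, `DstarPi`).  The Landau member of the EX display becomes the S twin below: print's (21) ∕ [Balaban1985RegularSpaces]
(1.38) «R(U₀)D^{η*}_{U₀}A = 0» with `R := R_S(U₀)`, read on the route's `X` (the `η⁻¹` of `A = η⁻¹X` is immaterial for a linear condition).  WEIGHTS: the `L²` weights `(c₀, cB)`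
(print: `c₀ = η³`, `cB = 1`) are PARAMETERS exactly as in p01's letters, so that p01's (3.124)-rows produce `IsLandauPrintS` with no adapter; the predicate's truth value does not
depend on them (uniform weights: `D*`, `Δ`, `ker(Q∘D)` and orthogonality are scale-invariant), its term does.  THE COMPETITOR SIDE of C-minˢ keeps print's comb `IsLandauPrint`
(supplied by lit Thm 2 via ✓`cov_of_thm2TorusAt`, (J1) of the knit ruler); the junction `IsLandauPrintS 1 X ↔ IsLandauPrint 1 X` at the flat background (where
`N_S(1) = ker Q_site ⊕ ℂ·1 ⊋ N(Q′(1)) = ker Q_site` but `Δ N_S(1) = Δ N(Q′(1))` since `Δ1 = 0`) is a separate M-row (kernel identification + the ℤ³-pullback∕multiplier dictionary of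
`B8Eq138Multiplier`), NOT part of this definitions append.
-/

section LandauS

open scoped InnerProductSpace
open B11Eq103H1Complex (SiteL2K BondL2K projR)
open Summit.QuantumFields.YangMills.Theorems.Prop7SectET3HilbertLetters (W₂ toL2 toL2S DL2 DstarL2 covLapSite)
open Summit.QuantumFields.YangMills.Theorems.Prop7SectET3Transport (periodsT3)
open Summit.QuantumFields.YangMills.Theorems.Prop7SectET3GaugeProjector (QDS NS RS RSPi DstarPi RSPi_apply DstarPi_apply RS_eq_projR)

variable (F n K h) (c₀ cB : ℝ) [Fact (0 < c₀)]

/-- **(21)ˢ «R_S(U₀)D*_{U₀}X = 0» — THE PROJECTED LANDAU GAUGE CONDITION FOR THE SYMMETRIC TUBE** (★★OWNER ACK 32 (q1)): the route's fine field `X` is orthogonal, after `D*_{U₀}`,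
to `Δ^η_{U₀} N_S(U₀)` — `RSPi U₀ (DstarPi U₀ X) = 0` with p01's intrinsic projector `R_S(U₀)` (onto `Δ^η_{U₀} ker(Q(U₀)∘D_{U₀})`, `Q := QTwS`) and covariant divergence (3.8),
read back on the route carriers; `L²` weights `(c₀, cB)` parametric (print: `η³`, `1`).  The S twin of `IsLandauPrint` (print's (21) ∕ (1.38) with the COMB `Q′`), replacing it on the
MINIMISER side of the EX display. [cite: Balaban1985Variational, (21) p.281, (45) p.285; Balaban1985RegularSpaces, (1.38) p.82; Balaban1985BackgroundPropagators, (3.8) p.392, (3.21)–(3.23) p.394, (3.110) p.417, (3.115) p.418] -/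
def IsLandauPrintS (U₀ : GaugeField (F.P K) 0 (Matrix.specialUnitaryGroup (Fin 2) ℂ)) (X : PBond (F.P K) 0 → Matrix (Fin 2) (Fin 2) ℂ) : Prop :=
  RSPi F n K h c₀ cB U₀ (DstarPi F n K c₀ U₀ X) = 0

variable {F n K h c₀ cB}

/-- `IsLandauPrintS` unfolded. [cite: Balaban1985Variational, (21) p.281] -/
theorem isLandauPrintS_iff (U₀ : GaugeField (F.P K) 0 (Matrix.specialUnitaryGroup (Fin 2) ℂ)) (X : PBond (F.P K) 0 → Matrix (Fin 2) (Fin 2) ℂ) :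
    IsLandauPrintS F n K h c₀ cB U₀ X ↔ RSPi F n K h c₀ cB U₀ (DstarPi F n K c₀ U₀ X) = 0 := Iff.rfl

/-- **(21)ˢ IS A LINEAR CONDITION**: `X ∈ ker (R_S(U₀) ∘ D*_{U₀})`. [cite: Balaban1985Variational, (21) p.281, (45) p.285] -/
theorem isLandauPrintS_iff_mem_ker (U₀ : GaugeField (F.P K) 0 (Matrix.specialUnitaryGroup (Fin 2) ℂ)) (X : PBond (F.P K) 0 → Matrix (Fin 2) (Fin 2) ℂ) :
    IsLandauPrintS F n K h c₀ cB U₀ X ↔ X ∈ LinearMap.ker (RSPi F n K h c₀ cB U₀ ∘ₗ DstarPi F n K c₀ U₀) := Iff.rfl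

/-- `X = 0` is in the Landau gauge. [cite: Balaban1985Variational, (21) p.281] -/
theorem isLandauPrintS_zero (U₀ : GaugeField (F.P K) 0 (Matrix.specialUnitaryGroup (Fin 2) ℂ)) : IsLandauPrintS F n K h c₀ cB U₀ 0 := by
  rw [isLandauPrintS_iff, map_zero, map_zero]

/-- (21)ˢ is additive in `X` (the Landau split of the chart exponent `X = A₁ + H₁B` adds the two members). [cite: Balaban1985Variational, (45) p.285, (102)–(103) p.293] -/
theorem IsLandauPrintS.add {U₀ : GaugeField (F.P K) 0 (Matrix.specialUnitaryGroup (Fin 2) ℂ)} {X₁ X₂ : PBond (F.P K) 0 → Matrix (Fin 2) (Fin 2) ℂ}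
    (h₁ : IsLandauPrintS F n K h c₀ cB U₀ X₁) (h₂ : IsLandauPrintS F n K h c₀ cB U₀ X₂) : IsLandauPrintS F n K h c₀ cB U₀ (X₁ + X₂) := by
  rw [isLandauPrintS_iff] at h₁ h₂ ⊢
  rw [map_add, map_add, h₁, h₂, add_zero]

/-- (21)ˢ is homogeneous in `X` (in particular invariant under print's rescaling `A = η⁻¹X`). [cite: Balaban1985Variational, (19)–(21) p.281] -/
theorem IsLandauPrintS.smul {U₀ : GaugeField (F.P K) 0 (Matrix.specialUnitaryGroup (Fin 2) ℂ)} {X : PBond (F.P K) 0 → Matrix (Fin 2) (Fin 2) ℂ}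
    (hX : IsLandauPrintS F n K h c₀ cB U₀ X) (a : ℂ) : IsLandauPrintS F n K h c₀ cB U₀ (a • X) := by
  rw [isLandauPrintS_iff] at hX ⊢
  rw [map_smul, map_smul, hX, smul_zero]

/-- **(21)ˢ ON THE HILBERT SPACES**: `IsLandauPrintS U₀ X ↔ R_S(U₀) (D*_{U₀} X̃) = 0` with `X̃ = toL2 X` (the readbacks `toL2S⁻¹` are bijective).
[cite: Balaban1985BackgroundPropagators, (3.8) p.392, (3.21) p.394] -/
theorem isLandauPrintS_iff_RS (U₀ : GaugeField (F.P K) 0 (Matrix.specialUnitaryGroup (Fin 2) ℂ)) (X : PBond (F.P K) 0 → Matrix (Fin 2) (Fin 2) ℂ) :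
    IsLandauPrintS F n K h c₀ cB U₀ X ↔ RS F n K h c₀ cB U₀ (DstarL2 F n K c₀ U₀ (toL2 F K c₀ X)) = 0 := by
  rw [isLandauPrintS_iff, RSPi_apply, DstarPi_apply, LinearEquiv.apply_symm_apply, LinearEquiv.map_eq_zero_iff]

/-- ★ **(21)ˢ IN PRINT'S MULTIPLIER ∕ ORTHOGONALITY FORM**: `R_S(U₀) D*_{U₀}X = 0` iff `D*_{U₀}X ⊥ Δ^η_{U₀}λ` for every `λ` in the residual gauge algebra `N_S(U₀) = ker(Q(U₀)∘D_{U₀})`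
— the S reading of (1.38) «`Δ^η_{U₀}(D^{η*}_{U₀}A) = Q′(U₀)ᵀμ`» (`R_S` is the orthogonal projection onto `(N_S).map Δ^η_{U₀}`, `projR`; zero iff orthogonal).
[cite: Balaban1985RegularSpaces, (1.38) p.82, (1.42) p.83; Balaban1985BackgroundPropagators, (3.21)–(3.23) p.394] -/
theorem isLandauPrintS_iff_orthogonal (U₀ : GaugeField (F.P K) 0 (Matrix.specialUnitaryGroup (Fin 2) ℂ)) (X : PBond (F.P K) 0 → Matrix (Fin 2) (Fin 2) ℂ) :
    IsLandauPrintS F n K h c₀ cB U₀ X ↔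
      ∀ l ∈ NS F n K h c₀ cB U₀, ⟪covLapSite F n K c₀ U₀ l, DstarL2 F n K c₀ U₀ (toL2 F K c₀ X)⟫_ℂ = 0 := by
  rw [isLandauPrintS_iff_RS, RS_eq_projR]
  haveI : CompleteSpace ↥((LinearMap.ker (QDS F n K h c₀ cB U₀)).map (covLapSite F n K c₀ U₀)) := FiniteDimensional.complete ℂ _
  change ((LinearMap.ker (QDS F n K h c₀ cB U₀)).map (covLapSite F n K c₀ U₀)).starProjection (DstarL2 F n K c₀ U₀ (toL2 F K c₀ X)) = 0 ↔ _
  rw [Submodule.starProjection_apply_eq_zero_iff, Submodule.mem_orthogonal]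
  constructor
  · intro H l hl
    exact H _ (Submodule.mem_map_of_mem hl)
  · rintro H u ⟨l, hl, rfl⟩
    exact H l hl

/-- **EQUIVALENTLY `Δ^η_{U₀}(D*_{U₀}X) ⊥ N_S(U₀)`** — the literal S reading of (1.38)'s «`Δ(D*A) ∈ range Q′ᵀ = N(Q′)^⊥`» (`Δ^η_{U₀} = D*D` is symmetric: `adjoint_DL2`).
[cite: Balaban1985RegularSpaces, (1.38) p.82; Balaban1985BackgroundPropagators, (3.23) p.394] -/
theorem isLandauPrintS_iff_covLapSite_mem_orthogonal (U₀ : GaugeField (F.P K) 0 (Matrix.specialUnitaryGroup (Fin 2) ℂ)) (X : PBond (F.P K) 0 → Matrix (Fin 2) (Fin 2) ℂ) :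
    IsLandauPrintS F n K h c₀ cB U₀ X ↔ covLapSite F n K c₀ U₀ (DstarL2 F n K c₀ U₀ (toL2 F K c₀ X)) ∈ (NS F n K h c₀ cB U₀)ᗮ := by
  rw [isLandauPrintS_iff_orthogonal, Submodule.mem_orthogonal]
  have hsymm : ∀ l f : SiteL2K ℂ 3 (periodsT3 F K) c₀ W₂, ⟪covLapSite F n K c₀ U₀ l, f⟫_ℂ = ⟪l, covLapSite F n K c₀ U₀ f⟫_ℂ := fun l f => by
    simp only [covLapSite, LinearMap.comp_apply]
    rw [← Prop7SectET3HilbertLetters.adjoint_DL2, LinearMap.adjoint_inner_left, LinearMap.adjoint_inner_right]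
  exact forall₂_congr fun l _ => by rw [hsymm]

end LandauS

end Summit.QuantumFields.YangMills.Theorems.Prop7SPrint

end
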